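import Summits.CriticalPhenomena.PercolationContinuityZ3.Theorems.PercNearOneGluingNoHeavyLowerTailPatternSunflower
import HarnessLib

/-!
# `NoHeavyLowerTail` (stmt-CriticalPhenomena-4575) — GLUED three-point sunflower rows (Aas–Gladkov on `G / X / Y / Z`)

Support file (prover prim-ineq-gen-2, new-inequality factory; `--supports stmt-CriticalPhenomena-4575`).  Three row
theorems (pattern tests written inline, as in `aasGladkov_pattern012`); no definitions, no named facts, no sorries.

WHY.  Every pseudo-law published by the `wf3lp` certificate programme for the three-relay rung
(`run/shared/lean/ttrl/wf3lp/fakelaw_*.json`, 21 vectors, including `z*` = `fakelaw_U13_noregime_comp3+shk+shkg`, the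
obstruction to Kozma–Nitzan's Question 7 at `|A| = 3` over two-set exchange + Harris + Reimer + MIX + all sunflower rows, and
the `harris2+all+dt` generation) violates an Aas–Gladkov three-point row of a GLUED graph: take three disjoint terminal SETS
`X, Y, Z`, add a surely-open edge inside each set (glue it to a point) and write the three-petal strong Harris–Kleitman
inequality of Gladkov (BLMS 2024, Thm. 2.1 / Cor. 4.2) for the three glued points,
    `μ(XY|Z)μ(XZ|Y) + μ(XY|Z)μ(YZ|X) + μ(XZ|Y)μ(YZ|X) ≤ μ(XYZ)·μ(X|Y|Z)`,
all events read in the glued graph.  Read back in `G` these are pattern events (e.g. "`X ~ Y` in the glued graph" =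
"some `x ∈ X` is joined to some `y ∈ Y`", closed under the glue), `A = {XYZ}` and `A ∪ {XY|Z} = {X ~ Y}` are increasing, the
petals are disjoint — so each row is `PatternSunflower.patternSunflower_three` with the side conditions decided on the 52
consistent patterns.  Up to the placement `v` of the five terminals there are three new types (`|X|,|Y|,|Z|` = 2,1,1 /
3,1,1 / 2,2,1; type 1,1,1 is `aasGladkov_pattern012`).  Harness record (ineq-harness GAG-211/311/221, report GAG-1.md):
0 violations on 454 488 exact realizable instances each; every one of the 21 pseudo-laws is cut (z*: exactly
`−7 920 502 911 · 10⁻¹²` by type 2,1,1 with `X = {a₁,a₂}, Y = {o}, Z = {a₃}`).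
Pair bits (`PatternCells`): `01↦0, 02↦1, 03↦2, 04↦3, 12↦4, 13↦5, 14↦6, 23↦7, 24↦8, 34↦9`.
* `gluedSunflower_211` — `X = {1,2}`, `Y = {0}`, `Z = {3}` (terminal `4` free): `X~Y = 0~1 ∨ 0~2` (bits 0,1), `X~Z = 1~3 ∨ 2~3` (bits 5,7), `Y~Z = 0~3` (bit 2);
* `gluedSunflower_311` — `X = {1,2,3}`, `Y = {0}`, `Z = {4}`: `X~Y` = bits 0,1,2, `X~Z` = bits 6,8,9, `Y~Z` = bit 3;
* `gluedSunflower_221` — `X = {1,2}`, `Y = {3,4}`, `Z = {0}`: `X~Y` = bits 5,6,7,8, `X~Z` = bits 0,1, `Y~Z` = bits 2,3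
  (in the glued graph `XYZ = X~Y ∧ (X~Z ∨ Y~Z)`, and `X~Z ∧ Y~Z ⇒ X~Y` on consistent patterns).
[cite: Gladkov2024StrongFKG, Thm. 2.1 and Cor. 4.2]
-/

noncomputable section

namespace Summit.CriticalPhenomena.PercolationContinuityZ3.Theorems

open MeasureTheory Set Literature.Probability.Percolation
open Literature.Probability.LatticeModels (prodBernoulli)
open scoped Classical BigOperators
open PatternCells CertCells PatternSunflower

namespace PatternSunflower

variable {n : ℕ}

/-- **Glued sunflower row, type 2,1,1.**  For every weighted graph on `Fin n` and every placement `v` of five terminals,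
with `X = {v 1, v 2}` glued to a point, `Y = v 0`, `Z = v 3` (events read in `G/X`; `X~Y = 0~1 ∨ 0~2`, `X~Z = 1~3 ∨ 2~3`):
`μ(XY|Z)μ(XZ|Y) + μ(XY|Z)μ(YZ|X) + μ(XZ|Y)μ(YZ|X) ≤ μ(XYZ)·μ(X|Y|Z)` where `XYZ = {X~Y} ∩ {X~Z}`, `XY|Z = {X~Y} ∖ {X~Z}`,
`XZ|Y = {X~Z} ∖ {X~Y}`, `YZ|X = {0~3} ∖ {X~Y}` and `X|Y|Z` is the complement of their union — Aas–Gladkov's three-point row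
on the glued graph, = `patternSunflower_three` with the side conditions decided on the 52 consistent patterns.  Every pseudo-law of
the wf3lp programme violates a relabelling of it (z*: by `7 920 502 911 · 10⁻¹²` with `X = {a₁,a₂}, Y = o, Z = a₃`).
[cite: Gladkov2024StrongFKG, Cor. 4.2] -/
theorem gluedSunflower_211 (w : Sym2 (Fin n) → unitInterval) (v : Fin 5 → Fin n) :
    (prodBernoulli w).real (PatEvent v fun m => (Nat.testBit m 0 || Nat.testBit m 1) && !(Nat.testBit m 5 || Nat.testBit m 7)) *
          (prodBernoulli w).real (PatEvent v fun m => (Nat.testBit m 5 || Nat.testBit m 7) && !(Nat.testBit m 0 || Nat.testBit m 1)) +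
        (prodBernoulli w).real (PatEvent v fun m => (Nat.testBit m 0 || Nat.testBit m 1) && !(Nat.testBit m 5 || Nat.testBit m 7)) *
          (prodBernoulli w).real (PatEvent v fun m => (Nat.testBit m 2) && !(Nat.testBit m 0 || Nat.testBit m 1)) +
        (prodBernoulli w).real (PatEvent v fun m => (Nat.testBit m 5 || Nat.testBit m 7) && !(Nat.testBit m 0 || Nat.testBit m 1)) *
          (prodBernoulli w).real (PatEvent v fun m => (Nat.testBit m 2) && !(Nat.testBit m 0 || Nat.testBit m 1)) ≤
      (prodBernoulli w).real (PatEvent v fun m => (Nat.testBit m 0 || Nat.testBit m 1) && (Nat.testBit m 5 || Nat.testBit m 7)) *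
        (prodBernoulli w).real
          (PatEvent v (fun m => (Nat.testBit m 0 || Nat.testBit m 1) && (Nat.testBit m 5 || Nat.testBit m 7)) ∪
            (PatEvent v (fun m => (Nat.testBit m 0 || Nat.testBit m 1) && !(Nat.testBit m 5 || Nat.testBit m 7)) ∪
              PatEvent v (fun m => (Nat.testBit m 5 || Nat.testBit m 7) && !(Nat.testBit m 0 || Nat.testBit m 1)) ∪
              PatEvent v (fun m => (Nat.testBit m 2) && !(Nat.testBit m 0 || Nat.testBit m 1))))ᶜ :=
  patternSunflower_three w v _ _ _ _ (by decide) (by decide) (by decide) (by decide) (by decide)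
    (by decide) (by decide) (by decide) (by decide) (by decide)

/-- **Glued sunflower row, type 3,1,1** (`X = {v 1, v 2, v 3}` glued, `Y = v 0`, `Z = v 4`; in the route's labelling the
relay set `A` glued, observer `o`, sink `b`): `μ(oA|b)μ(Ab|o) + μ(oA|b)μ(ob|A) + μ(Ab|o)μ(ob|A) ≤ μ(oAb)·μ(o|A|b)`, events read
in `G/A` (`o~A = 0~1 ∨ 0~2 ∨ 0~3`, `A~b = 1~4 ∨ 2~4 ∨ 3~4`, `ob|A = {0~4} ∖ {o~A}`).  Cuts the `(U)_3` / `(R1_0)_3`-B pseudo-laws by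
`3.6·10⁻²` / `2.8·10⁻²`. [cite: Gladkov2024StrongFKG, Cor. 4.2] -/
theorem gluedSunflower_311 (w : Sym2 (Fin n) → unitInterval) (v : Fin 5 → Fin n) :
    (prodBernoulli w).real (PatEvent v fun m => (Nat.testBit m 0 || Nat.testBit m 1 || Nat.testBit m 2) && !(Nat.testBit m 6 || Nat.testBit m 8 || Nat.testBit m 9)) *
          (prodBernoulli w).real (PatEvent v fun m => (Nat.testBit m 6 || Nat.testBit m 8 || Nat.testBit m 9) && !(Nat.testBit m 0 || Nat.testBit m 1 || Nat.testBit m 2)) +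
        (prodBernoulli w).real (PatEvent v fun m => (Nat.testBit m 0 || Nat.testBit m 1 || Nat.testBit m 2) && !(Nat.testBit m 6 || Nat.testBit m 8 || Nat.testBit m 9)) *
          (prodBernoulli w).real (PatEvent v fun m => (Nat.testBit m 3) && !(Nat.testBit m 0 || Nat.testBit m 1 || Nat.testBit m 2)) +
        (prodBernoulli w).real (PatEvent v fun m => (Nat.testBit m 6 || Nat.testBit m 8 || Nat.testBit m 9) && !(Nat.testBit m 0 || Nat.testBit m 1 || Nat.testBit m 2)) *
          (prodBernoulli w).real (PatEvent v fun m => (Nat.testBit m 3) && !(Nat.testBit m 0 || Nat.testBit m 1 || Nat.testBit m 2)) ≤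
      (prodBernoulli w).real (PatEvent v fun m => (Nat.testBit m 0 || Nat.testBit m 1 || Nat.testBit m 2) && (Nat.testBit m 6 || Nat.testBit m 8 || Nat.testBit m 9)) *
        (prodBernoulli w).real
          (PatEvent v (fun m => (Nat.testBit m 0 || Nat.testBit m 1 || Nat.testBit m 2) && (Nat.testBit m 6 || Nat.testBit m 8 || Nat.testBit m 9)) ∪
            (PatEvent v (fun m => (Nat.testBit m 0 || Nat.testBit m 1 || Nat.testBit m 2) && !(Nat.testBit m 6 || Nat.testBit m 8 || Nat.testBit m 9)) ∪
              PatEvent v (fun m => (Nat.testBit m 6 || Nat.testBit m 8 || Nat.testBit m 9) && !(Nat.testBit m 0 || Nat.testBit m 1 || Nat.testBit m 2)) ∪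
              PatEvent v (fun m => (Nat.testBit m 3) && !(Nat.testBit m 0 || Nat.testBit m 1 || Nat.testBit m 2))))ᶜ :=
  patternSunflower_three w v _ _ _ _ (by decide) (by decide) (by decide) (by decide) (by decide)
    (by decide) (by decide) (by decide) (by decide) (by decide)

/-- **Glued sunflower row, type 2,2,1** (`X = {v 1, v 2}` and `Y = {v 3, v 4}` glued, `Z = v 0`):
`μ(XY|Z)μ(XZ|Y) + μ(XY|Z)μ(YZ|X) + μ(XZ|Y)μ(YZ|X) ≤ μ(XYZ)·μ(X|Y|Z)` with `X~Y = 1~3 ∨ 1~4 ∨ 2~3 ∨ 2~4`,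
`XYZ = {X~Y} ∩ ({0~1 ∨ 0~2} ∪ {0~3 ∨ 0~4})`, `XY|Z = {X~Y} ∖ ({0~1 ∨ 0~2} ∪ {0~3 ∨ 0~4})`, `XZ|Y = {0~1 ∨ 0~2} ∖ {X~Y}`,
`YZ|X = {0~3 ∨ 0~4} ∖ {X~Y}`, read in `G/X/Y`.  The copy `X = {a₁,b}, Y = {o,a₃}, Z = a₂` is the row the `(R1_A)_3`-B pseudo-laws
violate most (`−6.97·10⁻³`). [cite: Gladkov2024StrongFKG, Cor. 4.2] -/
theorem gluedSunflower_221 (w : Sym2 (Fin n) → unitInterval) (v : Fin 5 → Fin n) :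
    (prodBernoulli w).real (PatEvent v fun m => (Nat.testBit m 5 || Nat.testBit m 6 || Nat.testBit m 7 || Nat.testBit m 8) && !(Nat.testBit m 0 || Nat.testBit m 1 || Nat.testBit m 2 || Nat.testBit m 3)) *
          (prodBernoulli w).real (PatEvent v fun m => (Nat.testBit m 0 || Nat.testBit m 1) && !(Nat.testBit m 5 || Nat.testBit m 6 || Nat.testBit m 7 || Nat.testBit m 8)) +
        (prodBernoulli w).real (PatEvent v fun m => (Nat.testBit m 5 || Nat.testBit m 6 || Nat.testBit m 7 || Nat.testBit m 8) && !(Nat.testBit m 0 || Nat.testBit m 1 || Nat.testBit m 2 || Nat.testBit m 3)) *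
          (prodBernoulli w).real (PatEvent v fun m => (Nat.testBit m 2 || Nat.testBit m 3) && !(Nat.testBit m 5 || Nat.testBit m 6 || Nat.testBit m 7 || Nat.testBit m 8)) +
        (prodBernoulli w).real (PatEvent v fun m => (Nat.testBit m 0 || Nat.testBit m 1) && !(Nat.testBit m 5 || Nat.testBit m 6 || Nat.testBit m 7 || Nat.testBit m 8)) *
          (prodBernoulli w).real (PatEvent v fun m => (Nat.testBit m 2 || Nat.testBit m 3) && !(Nat.testBit m 5 || Nat.testBit m 6 || Nat.testBit m 7 || Nat.testBit m 8)) ≤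
      (prodBernoulli w).real (PatEvent v fun m => (Nat.testBit m 5 || Nat.testBit m 6 || Nat.testBit m 7 || Nat.testBit m 8) && (Nat.testBit m 0 || Nat.testBit m 1 || Nat.testBit m 2 || Nat.testBit m 3)) *
        (prodBernoulli w).real
          (PatEvent v (fun m => (Nat.testBit m 5 || Nat.testBit m 6 || Nat.testBit m 7 || Nat.testBit m 8) && (Nat.testBit m 0 || Nat.testBit m 1 || Nat.testBit m 2 || Nat.testBit m 3)) ∪
            (PatEvent v (fun m => (Nat.testBit m 5 || Nat.testBit m 6 || Nat.testBit m 7 || Nat.testBit m 8) && !(Nat.testBit m 0 || Nat.testBit m 1 || Nat.testBit m 2 || Nat.testBit m 3)) ∪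
              PatEvent v (fun m => (Nat.testBit m 0 || Nat.testBit m 1) && !(Nat.testBit m 5 || Nat.testBit m 6 || Nat.testBit m 7 || Nat.testBit m 8)) ∪
              PatEvent v (fun m => (Nat.testBit m 2 || Nat.testBit m 3) && !(Nat.testBit m 5 || Nat.testBit m 6 || Nat.testBit m 7 || Nat.testBit m 8))))ᶜ :=
  patternSunflower_three w v _ _ _ _ (by decide) (by decide) (by decide) (by decide) (by decide)
    (by decide) (by decide) (by decide) (by decide) (by decide)

end PatternSunflower

end Summit.CriticalPhenomena.PercolationContinuityZ3.Theorems

end
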